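import Mathlib
import Summits.KontsevichZagierPeriods.KontsevichZagierPeriods.Theorems.SoloInformedDecidedHulls
import HarnessLib
import HarnessLib.Audit

/-!
# The circular order-four torsion packet: the `ℚ(s)`-identities (kernel of COR XXIX.10, circular)

Along the rational curve `M(s) = ((s²−1)/(2s))⁴`, `n(s) = (s−1)³(s+1)/(4s)` (`1 < s`, `s² < 2s+1`,
i.e. `1 < s < 1+√2`; then `0 < M < n < 1`: the CIRCULAR band, torsion parameter `a = K + iK′/4`)
the Pell–Abel unit is the quarter turn `h = (1 + ct²)√Δ + i·t(g₁ + g₃t²)` with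
`c = −(s−1)⁴/4`, `g₁ = (1+2s−s²)(3s²−2s+1)/(4s²)`, `g₃ = −(s−1)⁴(1+2s−s²)(s²+2s+3)/(16s²)`:
`|h|² = (1−nt²)⁴` and `2(CB′−C′B)Δ − CBΔ′ = (q₀ + q₂t²)(1−nt²)³` with
`q₀ = (1+2s−s²)(3s²−2s+1)/(2s²)`, `q₂ = (s−1)³(s+1)(1+2s−s²)(s²+2s+3)/(8s³)`, whence
`α = q₂/(q₂+nq₀) = (s²+2s+3)/(4(s²+1))`, `β = n/(q₂+nq₀) = s²/(2(s²+1)(1+2s−s²))` and (THEOREM XXXI′)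
`Π(n(s) | M(s)) = αK + βπ`; fibre `s = 2`: `Π(3/8 | 81/256) = 11K/20 + 2π/5`.  Pure algebra.
-/

noncomputable section

open Set

open Literature.NumberTheory.Transcendental Literature.NumberTheory.Transcendental.KZ
open Literature.ModelTheory.ExponentialFields

namespace Summit.KontsevichZagierPeriods.KontsevichZagierPeriods.Theorems

/-- The modulus `M(s) = ((s²−1)/(2s))⁴`. [this work] -/
def soloInformedQ4m (s : ℝ) : ℝ := (s ^ 2 - 1) ^ 4 / (16 * s ^ 4)

/-- The circular parameter `n(s) = (s−1)³(s+1)/(4s)`. [this work] -/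
def soloInformedQ4n (s : ℝ) : ℝ := (s - 1) ^ 3 * (s + 1) / (4 * s)

/-- `c(s)`: `C = 1 + ct²`. [this work] -/
def soloInformedQ4c (s : ℝ) : ℝ := -(s - 1) ^ 4 / 4

/-- `g₁(s)`: `B = t(g₁ + g₃t²)`. [this work] -/
def soloInformedQ4g₁ (s : ℝ) : ℝ := (1 + 2 * s - s ^ 2) * (3 * s ^ 2 - 2 * s + 1) / (4 * s ^ 2)

/-- `g₃(s)`: `B = t(g₁ + g₃t²)`. [this work] -/
def soloInformedQ4g₃ (s : ℝ) : ℝ :=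
  -((s - 1) ^ 4 * (1 + 2 * s - s ^ 2) * (s ^ 2 + 2 * s + 3)) / (16 * s ^ 2)

/-- `q₀(s)`. [this work] -/
def soloInformedQ4q₀ (s : ℝ) : ℝ := (1 + 2 * s - s ^ 2) * (3 * s ^ 2 - 2 * s + 1) / (2 * s ^ 2)

/-- `q₂(s)`. [this work] -/
def soloInformedQ4q₂ (s : ℝ) : ℝ :=
  (s - 1) ^ 3 * (s + 1) * (1 + 2 * s - s ^ 2) * (s ^ 2 + 2 * s + 3) / (8 * s ^ 3)

/-- `α(s) = (s²+2s+3)/(4(s²+1))`. [this work] -/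
def soloInformedQ4alpha (s : ℝ) : ℝ := (s ^ 2 + 2 * s + 3) / (4 * (s ^ 2 + 1))

/-- `β(s) = s²/(2(s²+1)(1+2s−s²))`. [this work] -/
def soloInformedQ4beta (s : ℝ) : ℝ := s ^ 2 / (2 * (s ^ 2 + 1) * (1 + 2 * s - s ^ 2))

/-- **The norm identity** `(1+ct²)²Δ + t²(g₁+g₃t²)² = (1−nt²)⁴`. [this work] -/
theorem soloInformed_q4_norm {s : ℝ} (hs : s ≠ 0) (t : ℝ) :
    (1 + soloInformedQ4c s * t ^ 2) ^ 2 * ((1 - t ^ 2) * (1 - soloInformedQ4m s * t ^ 2)) +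
        (t * (soloInformedQ4g₁ s + soloInformedQ4g₃ s * t ^ 2)) ^ 2 =
      (1 - soloInformedQ4n s * t ^ 2) ^ 4 := by
  unfold soloInformedQ4c soloInformedQ4m soloInformedQ4g₁ soloInformedQ4g₃ soloInformedQ4n
  field_simp
  ring

/-- **The numerator identity** `2(CB′−C′B)Δ − CBΔ′ = (q₀+q₂t²)(1−nt²)³`. [this work] -/
theorem soloInformed_q4_num {s : ℝ} (hs : s ≠ 0) (t : ℝ) :
    2 * ((1 + soloInformedQ4c s * t ^ 2) * (soloInformedQ4g₁ s + 3 * soloInformedQ4g₃ s * t ^ 2) -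
          2 * soloInformedQ4c s * t * (t * (soloInformedQ4g₁ s + soloInformedQ4g₃ s * t ^ 2))) *
        ((1 - t ^ 2) * (1 - soloInformedQ4m s * t ^ 2)) -
      (1 + soloInformedQ4c s * t ^ 2) * (t * (soloInformedQ4g₁ s + soloInformedQ4g₃ s * t ^ 2)) *
        (-(2 * t) * (1 - soloInformedQ4m s * t ^ 2) + (1 - t ^ 2) * (-(soloInformedQ4m s * (2 * t)))) =
    (soloInformedQ4q₀ s + soloInformedQ4q₂ s * t ^ 2) * (1 - soloInformedQ4n s * t ^ 2) ^ 3 := by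
  unfold soloInformedQ4c soloInformedQ4m soloInformedQ4g₁ soloInformedQ4g₃ soloInformedQ4n
    soloInformedQ4q₀ soloInformedQ4q₂
  field_simp
  ring

/-- `0 < M(s) < 1` for `1 < s`, `s² < 2s+1`. [this work] -/
theorem soloInformed_q4_m_mem {s : ℝ} (hs1 : 1 < s) (hs2 : s ^ 2 < 2 * s + 1) :
    soloInformedQ4m s ∈ Ioo (0:ℝ) 1 := by
  have h0 : 0 < s := by linarith
  have hu : 0 < (s ^ 2 - 1) / (2 * s) := by
    apply div_pos <;> nlinarith
  have hu1 : (s ^ 2 - 1) / (2 * s) < 1 := by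
    rw [div_lt_one (by linarith)]; linarith
  have e : soloInformedQ4m s = ((s ^ 2 - 1) / (2 * s)) ^ 4 := by
    unfold soloInformedQ4m; rw [div_pow]; ring
  rw [e]
  exact ⟨by positivity, pow_lt_one₀ hu.le hu1 (by norm_num)⟩

/-- `0 < n(s) < 1` for `1 < s`, `s² < 2s+1` (`(s−1)²(s²−1) < 2·2s`). [this work] -/
theorem soloInformed_q4_n_mem {s : ℝ} (hs1 : 1 < s) (hs2 : s ^ 2 < 2 * s + 1) :
    soloInformedQ4n s ∈ Ioo (0:ℝ) 1 := by
  have h0 : 0 < s := by linarith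
  have h1 : 0 < s - 1 := by linarith
  have h2 : (s - 1) ^ 2 < 2 := by nlinarith
  have h3 : 0 < s ^ 2 - 1 := by nlinarith
  have h4 : (s - 1) ^ 3 * (s + 1) = (s - 1) ^ 2 * (s ^ 2 - 1) := by ring
  unfold soloInformedQ4n
  rw [h4]
  refine ⟨by positivity, ?_⟩
  rw [div_lt_one (by linarith)]
  nlinarith [mul_lt_mul_of_pos_right h2 h3]

/-- `g₁ + g₃ = (s²+1)²(1+2s−s²)²/(16s²) > 0` and `g₃ ≤ 0` (`1 < s`, `s² < 2s+1`). [this work] -/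
theorem soloInformed_q4_g {s : ℝ} (hs1 : 1 < s) (hs2 : s ^ 2 < 2 * s + 1) :
    0 < soloInformedQ4g₁ s + soloInformedQ4g₃ s ∧ soloInformedQ4g₃ s ≤ 0 := by
  have h0 : 0 < s := by linarith
  have hw : 0 < 1 + 2 * s - s ^ 2 := by linarith
  have e : soloInformedQ4g₁ s + soloInformedQ4g₃ s =
      (s ^ 2 + 1) ^ 2 * (1 + 2 * s - s ^ 2) ^ 2 / (16 * s ^ 2) := by
    unfold soloInformedQ4g₁ soloInformedQ4g₃
    field_simp
    ring
  refine ⟨by rw [e]; positivity, ?_⟩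
  unfold soloInformedQ4g₃
  rw [neg_div]
  exact neg_nonpos.2 (by positivity)

/-- **The residue does not vanish**: `q₂ + nq₀ = (s−1)³(s+1)(s²+1)(1+2s−s²)/(2s³) > 0`.
[this work] -/
theorem soloInformed_q4_res {s : ℝ} (hs1 : 1 < s) (hs2 : s ^ 2 < 2 * s + 1) :
    0 < soloInformedQ4q₂ s + soloInformedQ4n s * soloInformedQ4q₀ s := by
  have h0 : 0 < s := by linarith
  have h1 : 0 < s - 1 := by linarith
  have hw : 0 < 1 + 2 * s - s ^ 2 := by linarith
  have e : soloInformedQ4q₂ s + soloInformedQ4n s * soloInformedQ4q₀ s =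
      (s - 1) ^ 3 * (s + 1) * (s ^ 2 + 1) * (1 + 2 * s - s ^ 2) / (2 * s ^ 3) := by
    unfold soloInformedQ4q₂ soloInformedQ4n soloInformedQ4q₀
    field_simp
    ring
  rw [e]
  positivity

/-- **The constants**: `q₂/(q₂+nq₀) = α(s)`, `n/(q₂+nq₀) = β(s)`. [this work] -/
theorem soloInformed_q4_alpha_beta {s : ℝ} (hs1 : 1 < s) (hs2 : s ^ 2 < 2 * s + 1) :
    soloInformedQ4q₂ s / (soloInformedQ4q₂ s + soloInformedQ4n s * soloInformedQ4q₀ s) =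
        soloInformedQ4alpha s ∧
      soloInformedQ4n s / (soloInformedQ4q₂ s + soloInformedQ4n s * soloInformedQ4q₀ s) =
        soloInformedQ4beta s := by
  have h0 : s ≠ 0 := by positivity
  have h1 : s - 1 ≠ 0 := sub_ne_zero.2 (by rintro rfl; linarith)
  have h2 : s + 1 ≠ 0 := by positivity
  have h3 : s ^ 2 + 1 ≠ 0 := by positivity
  have hw : 1 + 2 * s - s ^ 2 ≠ 0 := by nlinarith
  have hw' : 1 + s * 2 - s ^ 2 ≠ 0 := by nlinarith
  have hd := (soloInformed_q4_res hs1 hs2).ne'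
  have e : soloInformedQ4q₂ s + soloInformedQ4n s * soloInformedQ4q₀ s =
      (s - 1) ^ 3 * (s + 1) * (s ^ 2 + 1) * (1 + 2 * s - s ^ 2) / (2 * s ^ 3) := by
    unfold soloInformedQ4q₂ soloInformedQ4n soloInformedQ4q₀
    field_simp
    ring
  constructor
  · rw [e]
    unfold soloInformedQ4q₂ soloInformedQ4alpha
    field_simp
    ring
  · rw [e]
    unfold soloInformedQ4n soloInformedQ4beta
    field_simp
    ring

/-- All the constants are algebraic for algebraic `s`. [folklore] -/
theorem soloInformed_q4_isAlgebraic {s : ℝ} (hsa : IsAlgebraic ℚ s) :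
    IsAlgebraic ℚ (soloInformedQ4m s) ∧ IsAlgebraic ℚ (soloInformedQ4n s) ∧
      IsAlgebraic ℚ (soloInformedQ4c s) ∧ IsAlgebraic ℚ (soloInformedQ4g₁ s) ∧
      IsAlgebraic ℚ (soloInformedQ4g₃ s) ∧ IsAlgebraic ℚ (soloInformedQ4q₀ s) ∧
      IsAlgebraic ℚ (soloInformedQ4q₂ s) ∧ IsAlgebraic ℚ (soloInformedQ4alpha s) ∧
      IsAlgebraic ℚ (soloInformedQ4beta s) := by
  have hs : s ∈ algebraicClosure ℚ ℝ := mem_algebraicClosure_iff.2 hsa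
  have hN : ∀ k : ℕ, (k : ℝ) ∈ algebraicClosure ℚ ℝ := fun k => natCast_mem _ k
  have h2 : (2:ℝ) ∈ algebraicClosure ℚ ℝ := by exact_mod_cast hN 2
  have h3 : (3:ℝ) ∈ algebraicClosure ℚ ℝ := by exact_mod_cast hN 3
  have h4 : (4:ℝ) ∈ algebraicClosure ℚ ℝ := by exact_mod_cast hN 4
  have h8 : (8:ℝ) ∈ algebraicClosure ℚ ℝ := by exact_mod_cast hN 8
  have h16 : (16:ℝ) ∈ algebraicClosure ℚ ℝ := by exact_mod_cast hN 16
  refine ⟨mem_algebraicClosure_iff.1 ?_, mem_algebraicClosure_iff.1 ?_, mem_algebraicClosure_iff.1 ?_,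
    mem_algebraicClosure_iff.1 ?_, mem_algebraicClosure_iff.1 ?_, mem_algebraicClosure_iff.1 ?_,
    mem_algebraicClosure_iff.1 ?_, mem_algebraicClosure_iff.1 ?_, mem_algebraicClosure_iff.1 ?_⟩
  · unfold soloInformedQ4m; apply_rules (transparency := .reducible) (maxDepth := 250) only
      [pow_mem, div_mem, mul_mem, sub_mem, add_mem, one_mem, hs, h2, h4, h16]
  · unfold soloInformedQ4n; apply_rules (transparency := .reducible) (maxDepth := 250) only
      [pow_mem, div_mem, mul_mem, sub_mem, add_mem, one_mem, hs, h2, h4]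
  · unfold soloInformedQ4c; apply_rules (transparency := .reducible) (maxDepth := 250) only
      [pow_mem, div_mem, mul_mem, sub_mem, add_mem, one_mem, neg_mem, hs, h2, h4]
  · unfold soloInformedQ4g₁; apply_rules (transparency := .reducible) (maxDepth := 250) only
      [pow_mem, div_mem, mul_mem, sub_mem, add_mem, one_mem, hs, h2, h3, h4]
  · unfold soloInformedQ4g₃; apply_rules (transparency := .reducible) (maxDepth := 250) only
      [pow_mem, div_mem, mul_mem, sub_mem, add_mem, one_mem, neg_mem, hs, h2, h3, h4, h16]
  · unfold soloInformedQ4q₀; apply_rules (transparency := .reducible) (maxDepth := 250) only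
      [pow_mem, div_mem, mul_mem, sub_mem, add_mem, one_mem, hs, h2, h3, h4]
  · unfold soloInformedQ4q₂; apply_rules (transparency := .reducible) (maxDepth := 250) only
      [pow_mem, div_mem, mul_mem, sub_mem, add_mem, one_mem, hs, h2, h3, h4, h8]
  · unfold soloInformedQ4alpha; apply_rules (transparency := .reducible) (maxDepth := 250) only
      [pow_mem, div_mem, mul_mem, sub_mem, add_mem, one_mem, hs, h2, h3, h4]
  · unfold soloInformedQ4beta; apply_rules (transparency := .reducible) (maxDepth := 250) only
      [pow_mem, div_mem, mul_mem, sub_mem, add_mem, one_mem, hs, h2, h3, h4]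

/-- **The fibre `s = 2`**: `M = 81/256`, `n = 3/8`, `α = 11/20`, `β = 2/5`. [this work] -/
theorem soloInformed_q4_two : soloInformedQ4m 2 = 81 / 256 ∧ soloInformedQ4n 2 = 3 / 8 ∧
    soloInformedQ4alpha 2 = 11 / 20 ∧ soloInformedQ4beta 2 = 2 / 5 := by
  refine ⟨?_, ?_, ?_, ?_⟩
  · norm_num [soloInformedQ4m]
  · norm_num [soloInformedQ4n]
  · norm_num [soloInformedQ4alpha]
  · norm_num [soloInformedQ4beta]

end Summit.KontsevichZagierPeriods.KontsevichZagierPeriods.Theorems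

end
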